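/-
COR-CM (cell pub-hodgecm2 = stage 2 of the Hodge ladder), seat b17 gen 14 (prover-pub-hodgecm2-b17-g14-0, 2026-08-21),
display corollary F2 of RULING E-DISPLAY (3) (lead gen 4, 2026-08-21T00:52:52Z): the E term of record `hc_cm_of_PerLFace`
with ALL FOUR displayed data `hHD`, `hI`, `h₃`, `hR` instantiated by kernel theorems. Theorems only: no definition, no named
fact, no instance; no new constant of type `HC_CM_of_PerLFace` (RULING E-DEDUP).
-/
import Summits.HodgeConjecture.CorCM.Assembly.ModelChain
import Summits.HodgeConjecture.CorCM.Model.CMAbelianVarietyRealisedHolds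
import Literature.AlgebraicGeometry.HodgeTheory.AbelianVarietyHodgeFullnessHolds
import Literature.AlgebraicGeometry.HodgeTheory.ComplexConjugationHolds
import Literature.AlgebraicGeometry.HodgeTheory.HodgeFiltrationModelsReductionProofs
import HarnessLib

/-!
# The COR-CM E term, closed: `HC_CM` from the uniformisation record `h₁` and `PerLFace` alone

The stage-2 E term of record `hc_cm_of_PerLFace : HC_CM_of_PerLFace` (`CorCM/Assembly/ModelChain.lean`)
reads `∀ hHD hI h₁ h₃, U.PerLFace → DeligneMilne1982_Thm_6_20_full → HC_CM` for the model universe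
`U = Model.picardCMUniverse hHD hI h₁ h₃`. Four of its five data are now THEOREMS of the tree:
`hHD` (`exists_isReal_hodgeModel_holds`), `hI` (`hodgePQ_independent_of_hodgeModel_holds`),
`h₃ = PicardCM.CMAbelianVarietyRealised` (`cmAbelianVarietyRealised_holds`,
`CorCM/Model/CMAbelianVarietyRealisedHolds.lean`: Shimura 1998 §6.2 Thm. 3 on the algebraised CM torus, NO
hypothesis — so the universe below does not mention Riemann's theorem) and
`hR = DeligneMilne1982_Thm_6_20_full` (`deligneMilne1982_Thm_6_20_full_holds`,
`Literature/AlgebraicGeometry/HodgeTheory/AbelianVarietyHodgeFullnessHolds.lean`: Riemann's theorem, fullness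
clause, Deligne–Milne 1982 Thm. 6.20). This file records the closed form: **the Hodge conjecture for every
complex abelian variety of CM type (`HC_CM`, BY NAME
`Summit.HodgeConjecture.HodgeConjecture.Theses.RankFourFaces.CMAbelianHodge`) follows from the ball-quotient
uniformisation record `h₁ = PicardCM.BallQuotientUniformised` and the face-form period theorem `PerLFace`
on the model universe `Model.picardCMUniverse _ _ h₁ cmAbelianVarietyRealised_holds`** — displayed leaves
`{h₁, PerLFace}`.

## References
* [Shimura1998] G. Shimura, *Abelian Varieties with Complex Multiplication and Modular Functions* (1998), §6.2 Thm. 3.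
* [DeligneMilne1982Tannakian] P. Deligne, J. S. Milne, *Tannakian Categories*, LNM 900 (1982), §6 Thm. 6.20.
-/

noncomputable section

namespace Summit.HodgeConjecture.CorCM

open Literature.NumberTheory.Automorphic.PicardCM
open Literature.AlgebraicGeometry.HodgeTheory

/-- **`HC_CM` from `h₁` and `PerLFace` alone** — the E term `hc_cm_of_PerLFace` at the kernel leaves
`hHD ✓, hI ✓, h₃ ✓ (cmAbelianVarietyRealised_holds), hR ✓ (deligneMilne1982_Thm_6_20_full_holds)`: for every
ball-quotient uniformisation record `h₁`, the face-form period theorem on the model universe implies the Hodge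
conjecture for every complex abelian variety of CM type. [cite: Shimura1998, §6.2 Theorem 3 (pp. 41–42)]
[cite: DeligneMilne1982Tannakian, §6 Thm. 6.20 (Riemann), p. 212] -/
theorem hc_cm_closed (h₁ : BallQuotientUniformised)
    (hP : (Model.picardCMUniverse exists_isReal_hodgeModel_holds hodgePQ_independent_of_hodgeModel_holds h₁
      cmAbelianVarietyRealised_holds).PerLFace) : HC_CM :=
  hc_cm_of_PerLFace exists_isReal_hodgeModel_holds hodgePQ_independent_of_hodgeModel_holds h₁
    cmAbelianVarietyRealised_holds hP deligneMilne1982_Thm_6_20_full_holds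

end Summit.HodgeConjecture.CorCM

end
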